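import Summits.ResolutionOfSingularities.ResolutionOfSingularities.Theorems.HilbertSamuelEliminationCampaignW42ConeChartTwist
import Summits.ResolutionOfSingularities.ResolutionOfSingularities.Theorems.HilbertSamuelEliminationCampaignW42ConeRidgeClosedPoint
import HarnessLib

/-!
# [OURS · L1 W4.2] Ridge confinement for the blow-up of the vertex of a cone at ALL closed points of the
# exceptional divisor (any residue field, any characteristic) (campaign s42, cell res-hironaka; informal crux
# `RidgeConfinement`, stmt-ResolutionOfSingularities-17845; `--supports`)

HONEST FRAMING. OURS (slot W4.2, prover res-L1-s42-pv-1, gen 2): the non-rational complement of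
`…RidgeConeBlowup.lean` / `…RidgeConeBlowupLocal.lean` (rational points) and `…RidgeConeClosedPoints.lean`
(algebraically closed `K`). Let `I ⊆ S = K[X_1, …, X_n]` be a homogeneous ideal (cone `C = V(I)`), `j` a
chart of the blow-up `Bl_0(C)` of the vertex, `J = I.map (dehomog K j)` the strict transform ideal (= the ideal
of the tree's proper transforms, `map_dehomog_eq_span_coordProperTransform`), and `ξ` a CLOSED point of the
exceptional divisor `E ∩ U_j = {X_j = 0}`: a maximal ideal `𝔮' ⊇ J + (X_j)` of `S` with residue field
`κ = S/𝔮'` (ANY finite extension of `K`, separable or not) and tautological point `w' = (X_i mod 𝔮')_i ∈ κⁿ`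
(`w'_j = 0`).

* **`add_single_mem_ridge_of_iterPSum_le_exceptional`** — if `ξ` is NEAR to the vertex,
  `H(S/I)⁽ⁿ⁺¹⁾ ≤ H⁽ⁿ⁺¹⁾(𝒪_{Bl_0(C),ξ})` (`𝒪_{Bl_0(C),ξ} = (S/J)_{𝔮'}`), then the direction of `ξ` lies in the
  ridge: `w' + e_j ∈ F(C)(κ)`, i.e. `ξ ∈ ℙ(F(C))` — CJS Thm. 3.14 for the blow-up of the vertex of a cone at
  closed points, WITHOUT the perfectness hypothesis, ridge in place of directrix;
* `aeval_add_single_eq_zero_of_mem_ridgeIdeal_exceptional` — equivalently every equation `g ∈ 𝔉 = ridgeIdeal I`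
  of the ridge vanishes at `w' + e_j`;
* `mk_X_add_single_mem_ridge_of_isMaximal` — the self-contained form with `κ = S/𝔮'`.

Proof: the twist `Λ : X_i ↦ X_i(X_j + 1), X_j ↦ X_j + 1` identifies `𝒪_{Bl_0(C),ξ} = (S/J)_{𝔮'}` with a
localization of `S/I` at the closed point `𝔪 = Λ⁻¹(𝔮')` of the cone (`…ConeChartTwist.lean`:
`hilbertFun_localization_comap_twist_eq`), whose residue map is `s ↦ s(w' + e_j)`; then the closed-point
confinement `frame_point_mem_ridge_of_iterPSum_le` (`…ConeRidgeClosedPoint.lean`) applies.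

NOTHING here is a statement of H. Hironaka's manuscript [Hironaka2017]. AI review is weaker than expert review.
References (orientation only): V. Cossart, U. Jannsen, S. Saito, LNM 2270 (2020), Thm. 3.10, Def. 3.13,
Thm. 3.14, Rem. 3.15; J. Giraud, Ann. Sci. ÉNS 8 (1975) §1.5; H. Hironaka, Ann. of Math. 92 (1970).
-/

noncomputable section

-- single-conjunct summit: the doubled namespace component `ResolutionOfSingularities` is mandated
set_option linter.dupNamespace false

open MvPolynomial Module IsLocalRing
open Literature.RingTheory.HilbertSamuel
open Literature.RingTheory.MvPolynomial (shift shift_X)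
open Literature.AlgebraicGeometry.Resolution

namespace Summit.ResolutionOfSingularities.ResolutionOfSingularities.Theorems

namespace CampaignW42

universe u

variable {K : Type u} [Field K] {n : ℕ}

section Exceptional

variable {I : Ideal (MvPolynomial (Fin n) K)} (hI : IsHomogeneousIdeal I) (j : Fin n)
  {𝔮' : Ideal (MvPolynomial (Fin n) K)} [𝔮'.IsMaximal] (hJ𝔮' : I.map (dehomog K j) ≤ 𝔮')
  (hXj : (X j : MvPolynomial (Fin n) K) ∈ 𝔮')
  {κ : Type u} [Field κ] [Algebra K κ] (ρ' : MvPolynomial (Fin n) K →+* κ) (hρ' : Function.Surjective ρ')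
  (hkerρ' : RingHom.ker ρ' = 𝔮') (hρ'C : ∀ c : K, ρ' (C c) = algebraMap K κ c)
  [(𝔮'.map (Ideal.Quotient.mk (I.map (dehomog K j)))).IsMaximal]

include hI hJ𝔮' hXj hρ' hkerρ' hρ'C in
/-- **Ridge confinement on the exceptional divisor of the blow-up of the vertex of a cone, at a closed point
with arbitrary residue field `κ`**: if `ξ = 𝔮' ⊇ J + (X_j)` is near to the vertex,
`H(S/I)⁽ⁿ⁺¹⁾ ≤ H⁽ⁿ⁺¹⁾((S/J)_{𝔮'})`, then `w' + e_j ∈ F(C)(κ)` for the tautological point `w' = (ρ'X_i)_i`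
(`ρ' : S ↠ κ`, `ker ρ' = 𝔮'`): the closed point `ξ ∈ E = ℙ(C)` lies in `ℙ(F(C))`.
[cite: CossartJannsenSaito2020, Thm. 3.14] -/
theorem add_single_mem_ridge_of_iterPSum_le_exceptional
    (h : iterPSum (n + 1) (hilbertFunQuot K n I) ≤
      hilbertSamuelFun (Localization.AtPrime (𝔮'.map (Ideal.Quotient.mk (I.map (dehomog K j))))) (n + 1)) :
    (fun i => ρ' (X i)) + Pi.single j 1 ∈ ridge κ I := by
  -- the twist `Λ`
  let Λ : MvPolynomial (Fin n) K →ₐ[K] MvPolynomial (Fin n) K :=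
    (shift (Pi.single j (1 : K))).comp (coordBlowupSubst K (Set.univ : Set (Fin n)) j)
  have hΛj : Λ (X j) = X j + 1 := by
    simp only [Λ, AlgHom.comp_apply, coordBlowupSubst_X_self, shift_X, Pi.single_eq_same, C_1]
  have hΛ : ∀ i, i ≠ j → Λ (X i) = X i * (X j + 1) := fun i hi => by
    have h0 : (Pi.single j (1 : K) : Fin n → K) i = 0 := Pi.single_eq_of_ne hi 1
    simp only [Λ, AlgHom.comp_apply, coordBlowupSubst_X_of_mem_of_ne K Set.univ j (Set.mem_univ i) hi,
      map_mul, shift_X, Pi.single_eq_same, C_1, h0, C_0, add_zero, mul_comm]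
  have hρ'Xj : ρ' (X j) = 0 := by rw [← RingHom.mem_ker, hkerρ']; exact hXj
  -- the residue map `ρ₀ = ρ' ∘ Λ : s ↦ s(w' + e_j)` of the cone point `𝔪 = Λ⁻¹(𝔮')`
  let ρ₀ : MvPolynomial (Fin n) K →+* κ := ρ'.comp (Λ : MvPolynomial (Fin n) K →+* MvPolynomial (Fin n) K)
  have hρ₀ : ∀ s, ρ₀ s = ρ' (Λ s) := fun s => rfl
  have hρ₀X : ∀ i, ρ₀ (X i) = ((fun i => ρ' (X i)) + Pi.single j 1 : Fin n → κ) i := fun i => by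
    rw [hρ₀, Pi.add_apply]
    by_cases hi : i = j
    · subst hi
      rw [hΛj, map_add, map_one, hρ'Xj, Pi.single_eq_same]
    · rw [hΛ i hi, map_mul, map_add, map_one, hρ'Xj, zero_add, mul_one, Pi.single_eq_of_ne hi, add_zero]
  have hρ₀surj : Function.Surjective ρ₀ := by
    intro a
    obtain ⟨g, rfl⟩ := hρ' a
    let ev : MvPolynomial (Fin n) K →ₐ[K] MvPolynomial (Fin n) K :=
      aeval fun i => if i = j then (0 : MvPolynomial (Fin n) K) else X i
    refine ⟨ev g, ?_⟩
    have hcomp : ρ₀.comp (ev : MvPolynomial (Fin n) K →+* MvPolynomial (Fin n) K) = ρ' := by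
      refine MvPolynomial.ringHom_ext (fun c => ?_) (fun i => ?_)
      · rw [RingHom.comp_apply, RingHom.coe_coe, MvPolynomial.algHom_C, MvPolynomial.algebraMap_eq, hρ₀,
          MvPolynomial.algHom_C, MvPolynomial.algebraMap_eq]
      · rw [RingHom.comp_apply, RingHom.coe_coe, show ev (X i) = if i = j then 0 else X i from aeval_X _ i]
        by_cases hi : i = j
        · subst hi
          rw [if_pos rfl, map_zero, hρ'Xj]
        · rw [if_neg hi, hρ₀, hΛ i hi, map_mul, map_add, map_one, hρ'Xj, zero_add, mul_one]
    exact RingHom.congr_fun hcomp g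
  have hker : RingHom.ker ρ₀ =
      𝔮'.comap (Λ : MvPolynomial (Fin n) K →+* MvPolynomial (Fin n) K) := by
    ext x
    rw [RingHom.mem_ker, hρ₀, Ideal.mem_comap, RingHom.coe_coe, ← RingHom.mem_ker, hkerρ']
  haveI h𝔪max : (𝔮'.comap (Λ : MvPolynomial (Fin n) K →+* MvPolynomial (Fin n) K)).IsMaximal := by
    rw [← hker]
    exact RingHom.ker_isMaximal_of_surjective ρ₀ hρ₀surj
  have hI𝔪 : I ≤ 𝔮'.comap (Λ : MvPolynomial (Fin n) K →+* MvPolynomial (Fin n) K) :=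
    (le_comap_twist_map_dehomog j Λ hΛj hΛ hI).trans (Ideal.comap_mono hJ𝔮')
  -- `ρ : S/I ↠ κ`
  have hIker : ∀ a ∈ I, ρ₀ a = 0 := fun a ha => by
    rw [← RingHom.mem_ker, hker]
    exact hI𝔪 ha
  let ρ : (MvPolynomial (Fin n) K ⧸ I) →+* κ := Ideal.Quotient.lift I ρ₀ hIker
  have hρmk : ∀ s, ρ (Ideal.Quotient.mk I s) = ρ₀ s := fun s => Ideal.Quotient.lift_mk I ρ₀ hIker
  have hρ : Function.Surjective ρ := fun a => by
    obtain ⟨s, hs⟩ := hρ₀surj a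
    exact ⟨Ideal.Quotient.mk I s, by rw [hρmk, hs]⟩
  have hkerρ : RingHom.ker (ρ.comp (Ideal.Quotient.mk I)) =
      𝔮'.comap (Λ : MvPolynomial (Fin n) K →+* MvPolynomial (Fin n) K) := by
    rw [← hker]
    ext x
    simp only [RingHom.mem_ker, RingHom.comp_apply, hρmk]
  have hρC : ∀ c : K, ρ (Ideal.Quotient.mk I (C c)) = algebraMap K κ c := fun c => by
    rw [hρmk, hρ₀, MvPolynomial.algHom_C, MvPolynomial.algebraMap_eq, hρ'C]
  haveI := isMaximal_map_mk_of_le h𝔪max hI𝔪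
  haveI := isMaximal_map_C_sup_idealOfVars (n := n)
    ((𝔮'.comap (Λ : MvPolynomial (Fin n) K →+* MvPolynomial (Fin n) K)).map (Ideal.Quotient.mk I))
  -- `H(𝒪_{C,𝔪}) = H(𝒪_{Bl,ξ})`, so `𝔪` is near; confinement at the closed point `𝔪`
  have hH := hilbertFun_localization_comap_twist_eq j Λ hΛj hΛ hI hJ𝔮' hXj
  have h' : iterPSum (n + 1) (hilbertFunQuot K n I) ≤ hilbertSamuelFun (Localization.AtPrime
      ((𝔮'.comap (Λ : MvPolynomial (Fin n) K →+* MvPolynomial (Fin n) K)).map (Ideal.Quotient.mk I)))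
        (n + 1) := by
    rw [hilbertSamuelFun, hH]
    exact h
  have hmem := frame_point_mem_ridge_of_iterPSum_le (Ideal.Quotient.mk I) ρ hI Ideal.Quotient.mk_surjective
    Ideal.mk_ker hρ hkerρ hρC h'
  have heq : (fun i => ρ (Ideal.Quotient.mk I (X i))) = (fun i => ρ' (X i)) + Pi.single j 1 :=
    funext fun i => by rw [hρmk, hρ₀X]
  rw [← heq]
  exact hmem

include hI hJ𝔮' hXj hρ' hkerρ' hρ'C in
/-- The same, as equations: **every `g ∈ 𝔉 = ridgeIdeal I` vanishes at `w' + e_j`.**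
[cite: CossartJannsenSaito2020, Thm. 3.14] -/
theorem aeval_add_single_eq_zero_of_mem_ridgeIdeal_exceptional
    (h : iterPSum (n + 1) (hilbertFunQuot K n I) ≤
      hilbertSamuelFun (Localization.AtPrime (𝔮'.map (Ideal.Quotient.mk (I.map (dehomog K j))))) (n + 1))
    {g : MvPolynomial (Fin n) K} (hg : g ∈ ridgeIdeal I) :
    aeval ((fun i => ρ' (X i)) + Pi.single j (1 : κ)) g = 0 :=
  (mem_ridge_iff_forall_ridgeIdeal.mp
    (add_single_mem_ridge_of_iterPSum_le_exceptional hI j hJ𝔮' hXj ρ' hρ' hkerρ' hρ'C h)) g hg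

end Exceptional

/-- **Ridge confinement on the exceptional divisor of `Bl_0(C)`, self-contained form**: for a homogeneous
ideal `I ⊆ K[X_1, …, X_n]`, a chart `j`, `J = I.map (dehomog K j)`, and a maximal ideal `𝔮' ⊇ J + (X_j)` (a
closed point `ξ` of the exceptional divisor `E ∩ U_j`, ANY residue field) near to the vertex —
`H(S/I)⁽ⁿ⁺¹⁾ ≤ H⁽ⁿ⁺¹⁾((S/J)_{𝔮'})` — the direction `(X_i mod 𝔮')_i + e_j` of `ξ` lies in Giraud's ridge
`F(C)(S/𝔮')`: `ξ ∈ ℙ(F(C))`. [cite: CossartJannsenSaito2020, Thm. 3.14] -/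
theorem mk_X_add_single_mem_ridge_of_isMaximal {I : Ideal (MvPolynomial (Fin n) K)}
    (hI : IsHomogeneousIdeal I) (j : Fin n) {𝔮' : Ideal (MvPolynomial (Fin n) K)} [𝔮'.IsMaximal]
    (hJ𝔮' : I.map (dehomog K j) ≤ 𝔮') (hXj : (X j : MvPolynomial (Fin n) K) ∈ 𝔮')
    [(𝔮'.map (Ideal.Quotient.mk (I.map (dehomog K j)))).IsMaximal]
    (h : iterPSum (n + 1) (hilbertFunQuot K n I) ≤
      hilbertSamuelFun (Localization.AtPrime (𝔮'.map (Ideal.Quotient.mk (I.map (dehomog K j))))) (n + 1)) :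
    (fun i => Ideal.Quotient.mk 𝔮' (X i)) + Pi.single j 1 ∈ ridge (MvPolynomial (Fin n) K ⧸ 𝔮') I := by
  letI := Ideal.Quotient.field 𝔮'
  exact add_single_mem_ridge_of_iterPSum_le_exceptional hI j hJ𝔮' hXj (Ideal.Quotient.mk 𝔮')
    Ideal.Quotient.mk_surjective Ideal.mk_ker (fun c => rfl) h

end CampaignW42

end Summit.ResolutionOfSingularities.ResolutionOfSingularities.Theorems
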